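import Literature.Computability.QuantumComplexity.SU2DensityCriterion
import HarnessLib

/-!
# From the two-generator density criterion to a uniform net of words in `SU(2)`

Topic `Literature/Computability/QuantumComplexity`; sequel of `SU2DensityCriterion.lean`. The
braid compiler of the Jones-hardness reduction (Aharonov–Arad 2011, §3.3: "by Solovay–Kitaev, a
`δ`-approximation of each gate by a braid word of length `poly(log 1/δ)` is found in polynomial
time") starts, like Dawson–Nielsen's algorithm, from a FIXED-length net: some `l₀` such that every
element of `SU(2)` is within `ε₀` of a word of length `≤ l₀` in the generators. Here we derive
its existence from the criterion: `g, h ∈ U(2)` of determinant one satisfying the hypotheses of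
`closure_pairPhaseGen_eq_top` give, as elements of `Matrix.specialUnitaryGroup (Fin 2) ℂ`, an
inverse-closed generating set `G = {g, h, g⁻¹, h⁻¹}` with dense closure (`dense_closure_pairGen`),
whence `SolovayKitaev.exists_length_forall_wordApprox` applies (`exists_length_forall_wordApprox_pair`).

## References

* D. Aharonov, I. Arad, New J. Phys. 13 (2011) 035019, §3.3 [AharonovArad2011].
* C. M. Dawson, M. A. Nielsen, QIC 6 (2006), §3 [DawsonNielsen2006].
-/

noncomputable section

namespace Literature.Computability.QuantumComplexity

open Matrix

local notation "U2" => Matrix.unitaryGroup (Fin 2) ℂ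
local notation "SU2" => Matrix.specialUnitaryGroup (Fin 2) ℂ

/-- An element of `U(2)` of determinant one as an element of `SU(2)`. [folklore] -/
def toSU2 (g : U2) (hg : (g : Matrix (Fin 2) (Fin 2) ℂ).det = 1) : SU2 :=
  ⟨g, Matrix.mem_specialUnitaryGroup_iff.2 ⟨g.2, hg⟩⟩

/-- The inclusion `SU(2) →* U(2)`. [folklore] -/
def su2ToU2 : SU2 →* U2 where
  toFun x := ⟨x, x.2.1⟩
  map_one' := rfl
  map_mul' _ _ := rfl

/-- Underlying matrix of the inclusion. [folklore] -/
@[simp] theorem coe_su2ToU2 (x : SU2) : ((su2ToU2 x : U2) : Matrix (Fin 2) (Fin 2) ℂ) = x := rfl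

/-- The inclusion is continuous. [folklore] -/
theorem continuous_su2ToU2 : Continuous su2ToU2 :=
  Continuous.subtype_mk continuous_subtype_val _

/-- `su2ToU2 (toSU2 g) = g`. [folklore] -/
theorem su2ToU2_toSU2 (g : U2) (hg : (g : Matrix (Fin 2) (Fin 2) ℂ).det = 1) : su2ToU2 (toSU2 g hg) = g := rfl

/-- The inverse-closed generating set `{g, h, g⁻¹, h⁻¹} ⊆ SU(2)`. [folklore] -/
def pairGen (g h : U2) (hg : (g : Matrix (Fin 2) (Fin 2) ℂ).det = 1) (hh : (h : Matrix (Fin 2) (Fin 2) ℂ).det = 1) :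
    Set SU2 :=
  {toSU2 g hg, toSU2 h hh, (toSU2 g hg)⁻¹, (toSU2 h hh)⁻¹}

/-- `pairGen` is closed under inverses. [folklore] -/
theorem inv_mem_pairGen {g h : U2} (hg : (g : Matrix (Fin 2) (Fin 2) ℂ).det = 1)
    (hh : (h : Matrix (Fin 2) (Fin 2) ℂ).det = 1) : ∀ x ∈ pairGen g h hg hh, x⁻¹ ∈ pairGen g h hg hh := by
  intro x hx
  simp only [pairGen, Set.mem_insert_iff, Set.mem_singleton_iff] at hx ⊢
  rcases hx with rfl | rfl | rfl | rfl <;> simp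

/-- The image of `pairGen` contains `{g, h}`. [folklore] -/
theorem pair_subset_image_pairGen {g h : U2} (hg : (g : Matrix (Fin 2) (Fin 2) ℂ).det = 1)
    (hh : (h : Matrix (Fin 2) (Fin 2) ℂ).det = 1) : ({g, h} : Set U2) ⊆ su2ToU2 '' pairGen g h hg hh := by
  intro x hx
  simp only [Set.mem_insert_iff, Set.mem_singleton_iff] at hx
  rcases hx with rfl | rfl
  · exact ⟨toSU2 x hg, by simp [pairGen], rfl⟩
  · exact ⟨toSU2 x hh, by simp [pairGen], rfl⟩

/-- **Density in `SU(2)`** of the subgroup generated by `{g, h, g⁻¹, h⁻¹}`, under the hypotheses of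
the criterion. [cite: AharonovArad2011, §4] -/
theorem dense_closure_pairGen (g h : U2) (hg : (g : Matrix (Fin 2) (Fin 2) ℂ).det = 1)
    (hh : (h : Matrix (Fin 2) (Fin 2) ℂ).det = 1) (c : ℂ)
    (htr : (g : Matrix (Fin 2) (Fin 2) ℂ).trace ^ 2 = c * (g : Matrix (Fin 2) (Fin 2) ℂ).det)
    (hroot : ∀ μ : ℂ, μ + μ⁻¹ = c - 2 → ∀ m : ℕ, 0 < m → μ ^ m ≠ 1)
    (hcomm : h * g ≠ g * h)
    (hconj : (h : Matrix (Fin 2) (Fin 2) ℂ) * g * star (h : Matrix (Fin 2) (Fin 2) ℂ) ≠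
      (g : Matrix (Fin 2) (Fin 2) ℂ).det • star (g : Matrix (Fin 2) (Fin 2) ℂ)) :
    Dense ((Subgroup.closure (pairGen g h hg hh) : Subgroup SU2) : Set SU2) := by
  set Γ : Subgroup SU2 := Subgroup.closure (pairGen g h hg hh) with hΓ
  -- the image of `Γ` in `U(2)` contains `⟨g, h⟩`
  have hmap : Subgroup.closure ({g, h} : Set U2) ≤ Γ.map su2ToU2 := by
    rw [hΓ, MonoidHom.map_closure]
    exact Subgroup.closure_mono (pair_subset_image_pairGen hg hh)
  rw [dense_iff_closure_eq, Set.eq_univ_iff_forall]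
  intro A
  rw [mem_closure_iff]
  intro O hO hAO
  -- `O` is the trace of an open set of matrices; pull back to `U(2)`
  obtain ⟨O', hO', rfl⟩ := isOpen_induced_iff.1 hO
  have hAU : su2ToU2 A ∈ (Subgroup.closure ({g, h} : Set U2)).topologicalClosure :=
    mem_topologicalClosure_closure_pair_of_det_eq_one g h c htr hroot hcomm hconj (su2ToU2 A)
      (Matrix.mem_specialUnitaryGroup_iff.1 A.2).2
  have hAU' : su2ToU2 A ∈ closure ((Subgroup.closure ({g, h} : Set U2) : Set U2)) := by
    rw [← Subgroup.topologicalClosure_coe]; exact hAU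
  have hO'' : IsOpen (Subtype.val ⁻¹' O' : Set U2) := hO'.preimage continuous_subtype_val
  have hAO'' : su2ToU2 A ∈ (Subtype.val ⁻¹' O' : Set U2) := hAO
  obtain ⟨B, hBO, hBmem⟩ := mem_closure_iff.1 hAU' _ hO'' hAO''
  obtain ⟨B', hB', rfl⟩ := Subgroup.mem_map.1 (hmap hBmem)
  exact ⟨B', hBO, hB'⟩

/-- **The uniform net**: under the hypotheses of the criterion, for every `ε₀ > 0` there is a
length `l₀` such that every `U ∈ SU(2)` is within `ε₀` (operator norm) of a word of length `≤ l₀`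
in `g, h, g⁻¹, h⁻¹`. [cite: AharonovArad2011, §3.3] [cite: DawsonNielsen2006, §3] -/
theorem exists_length_forall_wordApprox_pair (g h : U2) (hg : (g : Matrix (Fin 2) (Fin 2) ℂ).det = 1)
    (hh : (h : Matrix (Fin 2) (Fin 2) ℂ).det = 1) (c : ℂ)
    (htr : (g : Matrix (Fin 2) (Fin 2) ℂ).trace ^ 2 = c * (g : Matrix (Fin 2) (Fin 2) ℂ).det)
    (hroot : ∀ μ : ℂ, μ + μ⁻¹ = c - 2 → ∀ m : ℕ, 0 < m → μ ^ m ≠ 1)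
    (hcomm : h * g ≠ g * h)
    (hconj : (h : Matrix (Fin 2) (Fin 2) ℂ) * g * star (h : Matrix (Fin 2) (Fin 2) ℂ) ≠
      (g : Matrix (Fin 2) (Fin 2) ℂ).det • star (g : Matrix (Fin 2) (Fin 2) ℂ))
    {ε₀ : ℝ} (hε₀ : 0 < ε₀) :
    ∃ l₀ : ℕ, ∀ U : SU2, SolovayKitaev.WordApprox (pairGen g h hg hh) l₀ ε₀ U :=
  SolovayKitaev.exists_length_forall_wordApprox (inv_mem_pairGen hg hh)
    (dense_closure_pairGen g h hg hh c htr hroot hcomm hconj) hε₀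

end Literature.Computability.QuantumComplexity

end
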